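import Literature.MathematicalPhysics.QuantumLattice.SourcedHubbardBlockCut
import Literature.MathematicalPhysics.QuantumLattice.FermionTorusBlockTiling
import Literature.MathematicalPhysics.QuantumLattice.PlaquettePairCouplings
import Literature.MathematicalPhysics.QuantumLattice.PlaquetteBreathingSelfDuality

/-!
# Route `CooperPairDMottWalk`, crux `CooperPairDMott` (stmt-HubbardSuperconductivity-1177):
# the plaquette decomposition of the intra-plaquette Hubbard Hamiltonian of the breathing torus

Support file for the stub `stub_pairTrialCeiling`. On the torus `Λ_L = FermionTorus 2 L` of even
side `L`, the intra-plaquette part of the breathing Hamiltonian,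
`hamiltonian (fermionTorusGraph 2 L \ ⊤.comap plaq) 1 U` (`plaq x = (x₀/2, x₁/2)`: hopping `1` and
repulsion `U` on the bonds inside the `2 × 2` plaquettes `{2m, 2m+1}²`), is the sum over the
`(L/2)²` plaquettes of the second quantisations `(f_c)_* H_plaq(U)` of ONE plaquette Hamiltonian
`plaquetteHamiltonian U = hubbardTorus 2 2 1 U` along the block embeddings
`f_c : Λ_2 ↪o Λ_L`, `X ↦ 2c + X` of the tree (`FermionTorus.exists_blockFamily` with block side `2`):
`hamiltonian_intra_eq_sum_jwEmbed`. Ingredients: the ranges of the `f_c` are the plaquettes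
(`mem_range_blockFamily_iff`, `mem_range_blockFamily_plaqIdx`), they are pairwise disjoint and cover
`Λ_L` (`biUnion_range_blockFamily_eq_univ`), an intra-plaquette bond of the torus joins two sites of
ONE plaquette that are adjacent in the plaquette 4-cycle and conversely
(`plaquetteGraph_adj_iff_intra_adj`), so the tree's block-cut identity
`sourced_sub_sum_jwEmbed_sub_onSiteSum_eq` (with no pair source) has no boundary term. Also the
regional particle numbers add up: `Σ_c (f_c)_* N = N` (`sum_jwEmbed_totalNumber_eq`).

References: D. Ruelle, *Statistical Mechanics* (1969) §2.2 (block decompositions); W.-F. Tsai,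
S. A. Kivelson, PRB 73 (2006) 214510 (the plaquette / checkerboard Hubbard model). All statements
are [folklore]; no definition is introduced.
-/

set_option linter.dupNamespace false

noncomputable section

namespace Summit.HubbardSuperconductivity.HubbardSuperconductivity.Theorems.CooperPairDMottWalk

open Matrix Finset Literature.MathematicalPhysics.QuantumLattice Literature.Probability.LatticeModels
open scoped ComplexOrder

/-! ### Coordinates of the plaquette blocks -/

section Blocks

variable {L : ℕ}

/-- The plaquette index of a site lies in `[0, L/2)²` for even `L`. [folklore] -/
theorem plaqIdx_mem_blocks (hL : Even L) (x : FermionTorus 2 L) :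
    (((ofLex x 0 : ℕ) / 2, (ofLex x 1 : ℕ) / 2) : ℕ × ℕ) ∈ Finset.range (L / 2) ×ˢ Finset.range (L / 2) := by
  obtain ⟨k, hk⟩ := hL
  have h0 := (ofLex x 0).isLt
  have h1 := (ofLex x 1).isLt
  rw [Finset.mem_product, Finset.mem_range, Finset.mem_range]
  constructor <;> omega

/-- **The range of the block embedding `f_c` is the plaquette `c`**: `x ∈ f_c(Λ_2)` iff
`(x₀/2, x₁/2) = c`. [folklore] -/
theorem mem_range_blockFamily_iff {f : FermionTorus 2 2 ↪o FermionTorus 2 L} {c : ℕ × ℕ}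
    (hf : ∀ X j, (ofLex (f X) j : ℕ) = ![c.1 * 2, c.2 * 2] j + (ofLex X j : ℕ)) (x : FermionTorus 2 L) :
    x ∈ (Finset.univ : Finset (FermionTorus 2 2)).map f.toEmbedding ↔
      (ofLex x 0 : ℕ) / 2 = c.1 ∧ (ofLex x 1 : ℕ) / 2 = c.2 := by
  rw [FermionTorus.mem_map_iff_coord hf, Fin.forall_fin_two]
  simp only [Matrix.cons_val_zero, Matrix.cons_val_one]
  omega

/-- Every site lies in the range of the block embedding of its own plaquette. [folklore] -/
theorem mem_range_blockFamily_plaqIdx {f : ℕ × ℕ → (FermionTorus 2 2 ↪o FermionTorus 2 L)}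
    (hf : ∀ c ∈ Finset.range (L / 2) ×ˢ Finset.range (L / 2), ∀ X j,
      (ofLex (f c X) j : ℕ) = ![c.1 * 2, c.2 * 2] j + (ofLex X j : ℕ))
    (hL : Even L) (x : FermionTorus 2 L) :
    x ∈ (Finset.univ : Finset (FermionTorus 2 2)).map
      (f ((ofLex x 0 : ℕ) / 2, (ofLex x 1 : ℕ) / 2)).toEmbedding :=
  (mem_range_blockFamily_iff (hf _ (plaqIdx_mem_blocks hL x)) x).2 ⟨rfl, rfl⟩

/-- **The plaquettes cover the torus** (even `L`). [folklore] -/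
theorem biUnion_range_blockFamily_eq_univ {f : ℕ × ℕ → (FermionTorus 2 2 ↪o FermionTorus 2 L)}
    (hf : ∀ c ∈ Finset.range (L / 2) ×ˢ Finset.range (L / 2), ∀ X j,
      (ofLex (f c X) j : ℕ) = ![c.1 * 2, c.2 * 2] j + (ofLex X j : ℕ))
    (hL : Even L) :
    (Finset.range (L / 2) ×ˢ Finset.range (L / 2)).biUnion
        (fun c => (Finset.univ : Finset (FermionTorus 2 2)).map (f c).toEmbedding) = Finset.univ := by
  refine Finset.eq_univ_of_forall fun x => Finset.mem_biUnion.2 ?_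
  exact ⟨_, plaqIdx_mem_blocks hL x, mem_range_blockFamily_plaqIdx hf hL x⟩

/-- The plaquette label of a site of the block `c` is `c` (as a function `Fin 2 → ℕ`). [folklore] -/
theorem plaq_blockFamily_apply {f : FermionTorus 2 2 ↪o FermionTorus 2 L} {c : ℕ × ℕ}
    (hf : ∀ X j, (ofLex (f X) j : ℕ) = ![c.1 * 2, c.2 * 2] j + (ofLex X j : ℕ)) (X : FermionTorus 2 2) :
    (fun i : Fin 2 => (ofLex (f X) i : ℕ) / 2) = ![c.1, c.2] := by
  funext i
  rw [hf]
  have hX := (ofLex X i).isLt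
  fin_cases i <;> simp only [Matrix.cons_val_zero, Matrix.cons_val_one, Fin.zero_eta, Fin.mk_one] <;> omega

end Blocks

/-! ### Torus adjacency in coordinates; intra-plaquette bonds are plaquette bonds -/

section Adjacency

variable {L : ℕ}

/-- A coordinate successor is a torus neighbour: if `y_j = x_j + 1` and the other coordinate agrees,
`x ∼ y` in the torus graph. [folklore] -/
theorem torusAdj_of_coord_succ {x y : FermionTorus 2 L} (j : Fin 2)
    (hj : (ofLex y j : ℕ) = (ofLex x j : ℕ) + 1) (hne : ∀ i, i ≠ j → (ofLex y i : ℕ) = (ofLex x i : ℕ)) :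
    (fermionTorusGraph 2 L).Adj x y := by
  rw [fermionTorusGraph_adj, torusGraph_adj_iff]
  refine ⟨fun h => ?_, Or.inl ⟨j, funext fun i => ?_⟩⟩
  · have h1 := congr_fun h j
    rw [FermionTorus.toTorusSite_apply, FermionTorus.toTorusSite_apply] at h1
    have h2 := nat_eq_of_zmod_cast_eq (ofLex x j).isLt (ofLex y j).isLt h1
    omega
  · by_cases hij : i = j
    · subst hij
      rw [Pi.add_apply, Pi.single_eq_same, FermionTorus.toTorusSite_apply,
        FermionTorus.toTorusSite_apply, hj]
      push_cast
      rfl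
    · rw [Pi.add_apply, Pi.single_eq_of_ne hij, add_zero, FermionTorus.toTorusSite_apply,
        FermionTorus.toTorusSite_apply, hne i hij]

/-- Torus neighbours differ in exactly one coordinate. [folklore] -/
theorem coords_of_torusAdj [NeZero L] {x y : FermionTorus 2 L} (h : (fermionTorusGraph 2 L).Adj x y) :
    ∃ j : Fin 2, (∀ i, i ≠ j → (ofLex y i : ℕ) = (ofLex x i : ℕ)) ∧ (ofLex y j : ℕ) ≠ (ofLex x j : ℕ) := by
  have hxy : x ≠ y := h.ne
  rw [fermionTorusGraph_adj, torusGraph_adj_iff] at h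
  obtain ⟨-, ⟨j, hj⟩ | ⟨j, hj⟩⟩ := h
  · obtain ⟨hne, -⟩ := coords_of_eq_add_single hj
    refine ⟨j, hne, fun heq => hxy (FermionTorus.ext_coord fun i => ?_)⟩
    by_cases hij : i = j
    · rw [hij, heq]
    · exact (hne i hij).symm
  · obtain ⟨hne, -⟩ := coords_of_eq_add_single hj
    refine ⟨j, fun i hij => (hne i hij).symm, fun heq => hxy (FermionTorus.ext_coord fun i => ?_)⟩
    by_cases hij : i = j
    · rw [hij, heq]
    · exact hne i hij

/-- Intra-plaquette adjacency unfolded: a torus bond whose ends carry the same plaquette label.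
[folklore] -/
theorem intra_adj_iff (x y : FermionTorus 2 L) :
    (fermionTorusGraph 2 L \ (⊤ : SimpleGraph (Fin 2 → ℕ)).comap
        (fun (x : FermionTorus 2 L) (i : Fin 2) => (ofLex x i : ℕ) / 2)).Adj x y ↔
      (fermionTorusGraph 2 L).Adj x y ∧
        (fun i : Fin 2 => (ofLex x i : ℕ) / 2) = fun i : Fin 2 => (ofLex y i : ℕ) / 2 := by
  rw [SimpleGraph.sdiff_adj, SimpleGraph.comap_adj, SimpleGraph.top_adj, not_not]

/-- **Block embeddings carry the plaquette 4-cycle onto the intra-plaquette bonds of the block.**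
[folklore] -/
theorem plaquetteGraph_adj_iff_intra_adj [NeZero L] {f : FermionTorus 2 2 ↪o FermionTorus 2 L} {c : ℕ × ℕ}
    (hf : ∀ X j, (ofLex (f X) j : ℕ) = ![c.1 * 2, c.2 * 2] j + (ofLex X j : ℕ)) (X Y : FermionTorus 2 2) :
    plaquetteGraph.Adj X Y ↔
      (fermionTorusGraph 2 L \ (⊤ : SimpleGraph (Fin 2 → ℕ)).comap
        (fun (x : FermionTorus 2 L) (i : Fin 2) => (ofLex x i : ℕ) / 2)).Adj (f X) (f Y) := by
  rw [intra_adj_iff, plaq_blockFamily_apply hf, plaq_blockFamily_apply hf]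
  simp only [and_true]
  have h0 := hf X 0; have h1 := hf X 1; have h0' := hf Y 0; have h1' := hf Y 1
  simp only [Matrix.cons_val_zero, Matrix.cons_val_one] at h0 h1 h0' h1'
  have hX0 := (ofLex X 0).isLt; have hX1 := (ofLex X 1).isLt
  have hY0 := (ofLex Y 0).isLt; have hY1 := (ofLex Y 1).isLt
  rw [plaquetteGraph_adj_iff]
  constructor
  · rintro (⟨he, hn⟩ | ⟨hn, he⟩)
    · have he' : (ofLex X 0 : ℕ) = (ofLex Y 0 : ℕ) := by rw [he]
      have hn' : (ofLex X 1 : ℕ) ≠ (ofLex Y 1 : ℕ) := fun h => hn (Fin.ext h)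
      rcases Nat.lt_or_gt_of_ne hn' with hlt | hlt
      · refine torusAdj_of_coord_succ 1 (by omega) fun i hi => ?_
        obtain rfl : i = 0 := by omega
        omega
      · refine (torusAdj_of_coord_succ (x := f Y) (y := f X) 1 (by omega) fun i hi => ?_).symm
        obtain rfl : i = 0 := by omega
        omega
    · have he' : (ofLex X 1 : ℕ) = (ofLex Y 1 : ℕ) := by rw [he]
      have hn' : (ofLex X 0 : ℕ) ≠ (ofLex Y 0 : ℕ) := fun h => hn (Fin.ext h)
      rcases Nat.lt_or_gt_of_ne hn' with hlt | hlt
      · refine torusAdj_of_coord_succ 0 (by omega) fun i hi => ?_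
        obtain rfl : i = 1 := by omega
        omega
      · refine (torusAdj_of_coord_succ (x := f Y) (y := f X) 0 (by omega) fun i hi => ?_).symm
        obtain rfl : i = 1 := by omega
        omega
  · intro h
    obtain ⟨j, hne, hj⟩ := coords_of_torusAdj h
    fin_cases j
    · right
      have e1 := hne 1 (by decide)
      refine ⟨fun heq => hj ?_, Fin.ext ?_⟩
      · change (ofLex (f Y) 0 : ℕ) = (ofLex (f X) 0 : ℕ)
        rw [h0, h0', heq]
      · change (ofLex (f Y) 1 : ℕ) = (ofLex (f X) 1 : ℕ) at e1
        omega
    · left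
      have e0 := hne 0 (by decide)
      refine ⟨Fin.ext ?_, fun heq => hj ?_⟩
      · change (ofLex (f Y) 0 : ℕ) = (ofLex (f X) 0 : ℕ) at e0
        omega
      · change (ofLex (f Y) 1 : ℕ) = (ofLex (f X) 1 : ℕ)
        rw [h1, h1', heq]

end Adjacency

/-! ### The decomposition -/

section Decomposition

variable {L : ℕ}

/-- An intra-plaquette bond lies inside one block: both ends are in the range of the block
embedding of the plaquette of the first end. [folklore] -/
theorem intra_adj_mem_range [NeZero L] (hL : Even L) {f : ℕ × ℕ → (FermionTorus 2 2 ↪o FermionTorus 2 L)}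
    (hf : ∀ c ∈ Finset.range (L / 2) ×ˢ Finset.range (L / 2), ∀ X j,
      (ofLex (f c X) j : ℕ) = ![c.1 * 2, c.2 * 2] j + (ofLex X j : ℕ))
    {x y : FermionTorus 2 L}
    (h : (fermionTorusGraph 2 L \ (⊤ : SimpleGraph (Fin 2 → ℕ)).comap
        (fun (x : FermionTorus 2 L) (i : Fin 2) => (ofLex x i : ℕ) / 2)).Adj x y) :
    x ∈ (Finset.univ : Finset (FermionTorus 2 2)).map (f ((ofLex x 0 : ℕ) / 2, (ofLex x 1 : ℕ) / 2)).toEmbedding ∧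
      y ∈ (Finset.univ : Finset (FermionTorus 2 2)).map (f ((ofLex x 0 : ℕ) / 2, (ofLex x 1 : ℕ) / 2)).toEmbedding := by
  refine ⟨mem_range_blockFamily_plaqIdx hf hL x, ?_⟩
  obtain ⟨-, hplaq⟩ := (intra_adj_iff x y).1 h
  have h0 : (ofLex x 0 : ℕ) / 2 = (ofLex y 0 : ℕ) / 2 := congr_fun hplaq 0
  have h1 : (ofLex x 1 : ℕ) / 2 = (ofLex y 1 : ℕ) / 2 := congr_fun hplaq 1
  rw [h0, h1]
  exact mem_range_blockFamily_plaqIdx hf hL y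

/-- **The plaquette decomposition of the intra-plaquette Hubbard Hamiltonian** (even `L`): with the
block embeddings `f_c : Λ_2 ↪o Λ_L`, `X ↦ 2c + X`, `c ∈ [0, L/2)²`,
`hamiltonian (G_L \ ⊤.comap plaq) 1 U = Σ_c (f_c)_* plaquetteHamiltonian U`. [folklore] -/
theorem hamiltonian_intra_eq_sum_jwEmbed [NeZero L] (hL : Even L) (U : ℝ)
    {f : ℕ × ℕ → (FermionTorus 2 2 ↪o FermionTorus 2 L)}
    (hf : ∀ c ∈ Finset.range (L / 2) ×ˢ Finset.range (L / 2), ∀ X j,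
      (ofLex (f c X) j : ℕ) = ![c.1 * 2, c.2 * 2] j + (ofLex X j : ℕ)) :
    hamiltonian (fermionTorusGraph 2 L \ (⊤ : SimpleGraph (Fin 2 → ℕ)).comap
        (fun (x : FermionTorus 2 L) (i : Fin 2) => (ofLex x i : ℕ) / 2)) 1 U =
      ∑ c ∈ Finset.range (L / 2) ×ˢ Finset.range (L / 2), jwEmbed (orbEmb (f c)) (plaquetteHamiltonian U) := by
  classical
  set T := Finset.range (L / 2) ×ˢ Finset.range (L / 2) with hT
  have hdisj : ∀ c ∈ T, ∀ c' ∈ T, c ≠ c' → ∀ X Y, f c X ≠ f c' Y :=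
    FermionTorus.blockFamily_ne (M := 2) (by norm_num) hf
  have hG : ∀ c ∈ T, ∀ X Y, plaquetteGraph.Adj X Y ↔
      (fermionTorusGraph 2 L \ (⊤ : SimpleGraph (Fin 2 → ℕ)).comap
        (fun (x : FermionTorus 2 L) (i : Fin 2) => (ofLex x i : ℕ) / 2)).Adj (f c X) (f c Y) :=
    fun c hc X Y => plaquetteGraph_adj_iff_intra_adj (hf c hc) X Y
  have key := sourced_sub_sum_jwEmbed_sub_onSiteSum_eq T f hdisj
    (fermionTorusGraph 2 L \ (⊤ : SimpleGraph (Fin 2 → ℕ)).comap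
      (fun (x : FermionTorus 2 L) (i : Fin 2) => (ofLex x i : ℕ) / 2))
    plaquetteGraph hG 1 U 0 0 (fun _ => (0 : ℂ)) (fun _ => (0 : ℂ)) (fun _ _ _ => rfl)
  -- no pair source, no chemical potential
  have e0 : ∀ M : Matrix (Finset (Orb (FermionTorus 2 L))) (Finset (Orb (FermionTorus 2 L))) ℂ,
      ((0 : ℝ) : ℂ) • M = 0 := fun M => by rw [Complex.ofReal_zero, zero_smul]
  have e0' : ∀ M : Matrix (Finset (Orb (FermionTorus 2 2))) (Finset (Orb (FermionTorus 2 2))) ℂ,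
      ((0 : ℝ) : ℂ) • M = 0 := fun M => by rw [Complex.ofReal_zero, zero_smul]
  rw [e0, sub_zero, e0', sub_zero, e0, sub_zero, hamiltonianWith_zero, hamiltonianWith_zero] at key
  -- the blocks cover everything: no atomic rest
  rw [biUnion_range_blockFamily_eq_univ hf hL, Finset.compl_univ, onSiteSum, Finset.sum_empty,
    sub_zero] at key
  -- no bond outside the blocks carries a coupling
  have hbonds : ∑ b ∈ (T.biUnion fun c => (Finset.univ : Finset (Bond (FermionTorus 2 2))).map
      ⟨bondMap (f c), bondMap_injective (f c)⟩)ᶜ,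
      hubbardCoupling (fermionTorusGraph 2 L \ (⊤ : SimpleGraph (Fin 2 → ℕ)).comap
        (fun (x : FermionTorus 2 L) (i : Fin 2) => (ofLex x i : ℕ) / 2)) ((1 : ℝ) : ℂ) b • bondOp b = 0 := by
    refine Finset.sum_eq_zero fun b hb => ?_
    rw [hubbardCoupling_apply]
    split_ifs with hadj
    · exfalso
      rw [Finset.mem_compl, Finset.mem_biUnion, not_exists] at hb
      obtain ⟨hx, hy⟩ := intra_adj_mem_range hL hf hadj
      obtain ⟨X, -, hX⟩ := Finset.mem_map.1 hx
      obtain ⟨Y, -, hY⟩ := Finset.mem_map.1 hy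
      refine hb _ ⟨plaqIdx_mem_blocks hL b.1, Finset.mem_map.2 ⟨(X, Y, b.2.2), Finset.mem_univ _, ?_⟩⟩
      exact Prod.ext hX (Prod.ext hY rfl)
    · rw [zero_smul]
  rw [hbonds, neg_zero] at key
  exact sub_eq_zero.1 key

/-- The ranges of distinct plaquette blocks carry disjoint orbital sets. [folklore] -/
theorem disjoint_orbs_range_blockFamily {f : ℕ × ℕ → (FermionTorus 2 2 ↪o FermionTorus 2 L)}
    (hf : ∀ c ∈ Finset.range (L / 2) ×ˢ Finset.range (L / 2), ∀ X j,
      (ofLex (f c X) j : ℕ) = ![c.1 * 2, c.2 * 2] j + (ofLex X j : ℕ)) :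
    ∀ c ∈ Finset.range (L / 2) ×ˢ Finset.range (L / 2), ∀ c' ∈ Finset.range (L / 2) ×ˢ Finset.range (L / 2),
      c ≠ c' → Disjoint (orbs ((Finset.univ : Finset (FermionTorus 2 2)).map (f c).toEmbedding))
        (orbs ((Finset.univ : Finset (FermionTorus 2 2)).map (f c').toEmbedding)) := by
  intro c hc c' hc' hne
  refine disjoint_orbs ?_
  exact disjoint_map_of_ne_range _ f (FermionTorus.blockFamily_ne (M := 2) (by norm_num) hf)
    (fun _ => Finset.univ) c hc c' hc' hne

/-- **The plaquette particle numbers add up to the total particle number** (even `L`):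
`Σ_c (f_c)_* N = N`. [folklore] -/
theorem sum_jwEmbed_totalNumber_eq (hL : Even L) {f : ℕ × ℕ → (FermionTorus 2 2 ↪o FermionTorus 2 L)}
    (hf : ∀ c ∈ Finset.range (L / 2) ×ˢ Finset.range (L / 2), ∀ X j,
      (ofLex (f c X) j : ℕ) = ![c.1 * 2, c.2 * 2] j + (ofLex X j : ℕ)) :
    ∑ c ∈ Finset.range (L / 2) ×ˢ Finset.range (L / 2),
        jwEmbed (orbEmb (f c)) (totalNumber : Matrix (Finset (Orb (FermionTorus 2 2))) (Finset (Orb (FermionTorus 2 2))) ℂ) =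
      (totalNumber : Matrix (Finset (Orb (FermionTorus 2 L))) (Finset (Orb (FermionTorus 2 L))) ℂ) := by
  classical
  rw [Finset.sum_congr rfl fun c _ => jwEmbed_totalNumber (f c), ← numberDiag_biUnion _ _
    (disjoint_orbs_range_blockFamily hf), ← orbs_biUnion, biUnion_range_blockFamily_eq_univ hf hL,
    ← totalNumber_eq_numberDiag_univ]

/-- There are `(L/2)²` plaquettes. [folklore] -/
theorem card_blocks_half (L : ℕ) : (Finset.range (L / 2) ×ˢ Finset.range (L / 2)).card = (L / 2) ^ 2 :=
  FermionTorus.card_blocks (L / 2)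

end Decomposition

/-! ### Registered form -/

/-- **Registered sub-goal `pairTrialCeiling_plaquetteDecomposition`** (closed form, as registered on
the crux item): the intra-plaquette Hubbard Hamiltonian of the breathing torus of even side is the sum
of the embedded plaquette Hamiltonians over the block family `X ↦ 2c + X`. [folklore] -/
theorem pairTrialCeiling_plaquetteDecomposition : ∀ {L : ℕ} [NeZero L], Even L → ∀ (U : ℝ) {f : ℕ × ℕ → (FermionTorus 2 2 ↪o FermionTorus 2 L)}, (∀ c ∈ Finset.range (L / 2) ×ˢ Finset.range (L / 2), ∀ X j, (ofLex (f c X) j : ℕ) = ![c.1 * 2, c.2 * 2] j + (ofLex X j : ℕ)) → hamiltonian (fermionTorusGraph 2 L \ (⊤ : SimpleGraph (Fin 2 → ℕ)).comap (fun (x : FermionTorus 2 L) (i : Fin 2) => (ofLex x i : ℕ) / 2)) 1 U = ∑ c ∈ Finset.range (L / 2) ×ˢ Finset.range (L / 2), jwEmbed (orbEmb (f c)) (plaquetteHamiltonian U) :=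
  fun hL U _ hf => hamiltonian_intra_eq_sum_jwEmbed hL U hf

end Summit.HubbardSuperconductivity.HubbardSuperconductivity.Theorems.CooperPairDMottWalk

end
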